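import Literature.Geometry.Kaehler.ComplexTorusCoordOneForms
import Literature.Barriers.HodgeConjecture.KaehlerCoherentSheavesRationalFormsProofs
import Literature.AlgebraicGeometry.HodgeTheory.SupportedClassesRational
import Literature.AlgebraicGeometry.HodgeTheory.RealStructureSingular
import Literature.AlgebraicTopology.SingularHomology.TorusBettiOne
import HarnessLib

/-!
# Rational classes of degree one on a complex torus (through a natural de Rham comparison)

Degree-one companion of `Literature/Barriers/HodgeConjecture/KaehlerCoherentSheavesRationalFormsProofs`
(which treats `H²`). Let `X = E/Φ(ℤ^ι)` be a complex torus (`ComplexTorus Φ`, `Φ : ℝ^ι ≃ E` a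
period isomorphism) and `e` ANY natural complex de Rham comparison family
(`ComplexDeRhamIsoFamily.IsNatural`; de Rham's theorem provides one). Every class of `H¹(X; ℂ)` is
`e[ω]` for a unique invariant one-form `ω ∈ Alt¹_ℝ(E; ℂ)` (Lange–Birkenhake, Prop. 1.1.20, tree
`ComplexTorus.cconstClassEquiv`), and `Alt¹_ℝ(E; ℂ)` has the basis of lattice-coordinate forms `dxₐ`
(`ComplexTorus.linearIndependent_dx`, `span_dx_eq_top`). Lange–Birkenhake Lemma 1.1.17 /
§1.1.4: "`H¹(X, ℤ) = Hom(Λ, ℤ)`", i.e. under the de Rham isomorphism the rational classes are the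
forms with rational values on the lattice. For an UN-NORMALISED comparison `e` this holds up to one
scalar, which is all the Hodge-theoretic consumer needs. We PROVE:

* `finrank_singularCohomology_rat_complexTorus_one` — `dim_ℚ H¹(X; ℚ) = |ι|` (Hatcher §3.3 with
  universal coefficients; tree `finrank_singularCohomology_one_of_homeomorph_realTorus`);
* (from `Barriers/HodgeConjecture/KaehlerCoherentSheavesRationalFormsProofs`:
  `isRationalClass_cconstClass_comp_realRep` — rational classes of invariant forms are stable under
  `ω ↦ ω ∘ ρ(B)` for every integer matrix `B`, by naturality of `e` under the real-smooth
  endomorphism `mapMatrix B`);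
* `exists_ne_zero_isRationalClass_smul_dx` — **there is `g ∈ ℂˣ` such that all the classes
  `e[g · dxₐ]` are rational**, hence (`isRationalClass_smul_sum_ratCast_smul_dx`) so are all
  `e[g · Σₐ qₐ dxₐ]`, `q ∈ ℚ^ι`. Proof: if `ι` is empty take `g = 1`; otherwise
  `dim_ℚ H¹(X; ℚ) = |ι| ≥ 1` gives a non-zero rational class `e[γ]`, some lattice coordinate
  `g = γ(Φeₐ)` of `γ` is non-zero, and for every `c` the rank-one integer matrix `B` with `Be_c = eₐ`
  has `γ ∘ ρ(B) = g · dx_c` (`ComplexTorus.comp_realRep_elementary₁`), a rational class.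

No definition and no named fact is introduced. Consumer: the weight-one Hodge structure of an
algebraic complex torus (`HodgeTheory/ComplexTorusWeightOneComparison`).

## References

* [LangeBirkenhake1992] H. Lange, Ch. Birkenhake, Complex Abelian Varieties, §1.1.2 (rational
  and analytic representations), §1.1.3 Lemma 1.1.17, §1.1.4 Prop. 1.1.20.
* [HatcherAT2002] A. Hatcher, Algebraic Topology (2002), §3.1 Thm. 3.2 and p. 198; §3.3 p. 231.
-/

noncomputable section

open scoped Manifold ContDiff

namespace Literature.AlgebraicGeometry.HodgeTheory

open Literature.AlgebraicTopology.SingularHomology Literature.NumberTheory.Transcendental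
  Literature.Geometry.Kaehler

section RationalOneForms

variable {ι : Type} [Fintype ι]
variable {E : Type} [NormedAddCommGroup E] [NormedSpace ℂ E] [FiniteDimensional ℂ E]
variable (Φ : (ι → ℝ) ≃L[ℝ] E)

omit [FiniteDimensional ℂ E] in
/-- **`dim_ℚ H¹(X; ℚ) = |ι|`** for the complex torus `X = E/Φ(ℤ^ι)` (it IS the real torus
`(ℝ/ℤ)^ι`; Hatcher §3.3 p. 231 with universal coefficients Thm. 3.2; Lange–Birkenhake Lemma 1.1.17:
`H¹(X, ℤ) = Hom(Λ, ℤ) ≅ ℤ^{2g}`). [cite: HatcherAT2002, §3.3 p. 231 and §3.1 Thm. 3.2]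
[cite: LangeBirkenhake1992, §1.1.3 Lemma 1.1.17] -/
theorem finrank_singularCohomology_rat_complexTorus_one :
    Module.finrank ℚ (singularCohomology ℚ ℚ (ComplexTorus Φ) 1) = Fintype.card ι :=
  finrank_singularCohomology_one_of_homeomorph_realTorus ι (ComplexTorus.toRealTorus Φ)

/-- **The rational structure of `H¹` of a complex torus, up to one scalar.** For every natural
complex de Rham comparison family `e` there is `g ≠ 0` in `ℂ` such that all the classes
`e[g · dxₐ] ∈ H¹(X; ℂ)` of the (rescaled) lattice-coordinate one-forms are rational
(Lange–Birkenhake Lemma 1.1.17: `H¹(X, ℤ) = Hom(Λ, ℤ)`; for the integration comparison `g = 1`).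
[cite: LangeBirkenhake1992, §1.1.3 Lemma 1.1.17 and §1.1.4 Prop. 1.1.20]
[cite: HatcherAT2002, §3.1 Thm. 3.2 and p. 198] -/
theorem exists_ne_zero_isRationalClass_smul_dx {e : ComplexDeRhamIsoFamily E} (he : e.IsNatural) :
    ∃ g : ℂ, g ≠ 0 ∧ ∀ a : ι,
      IsRationalClass (e (ComplexTorus Φ) 1 (ComplexTorus.cconstClass Φ (g • ComplexTorus.dx Φ a))) := by
  classical
  cases isEmpty_or_nonempty ι with
  | inl hι => exact ⟨1, one_ne_zero, fun a => (IsEmpty.false a).elim⟩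
  | inr hι =>
    -- a non-zero rational class in `H¹(X; ℂ)`
    have hpos : 0 < Module.finrank ℚ (singularCohomology ℚ ℚ (ComplexTorus Φ) 1) := by
      rw [finrank_singularCohomology_rat_complexTorus_one Φ]
      exact Fintype.card_pos
    haveI := Module.nontrivial_of_finrank_pos hpos
    obtain ⟨y, hy⟩ := exists_ne (0 : singularCohomology ℚ ℚ (ComplexTorus Φ) 1)
    set r := ofRatClass (ComplexTorus Φ) 1 y with hr
    have hr0 : r ≠ 0 := fun h => hy (ofRatClass_injective 1 (by rw [← hr, h, map_zero]))
    have hrrat : IsRationalClass r := isRationalClass_ofRatClass y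
    -- its invariant form `γ`, `e[γ] = r`
    set γ : E [⋀^Fin 1]→L[ℝ] ℂ :=
      (ComplexTorus.cconstClassEquiv Φ (k := 1)).symm ((e (ComplexTorus Φ) 1).symm r) with hγ
    have heγ : e (ComplexTorus Φ) 1 (ComplexTorus.cconstClass Φ γ) = r := by
      rw [hγ, ← ComplexTorus.cconstClassEquiv_apply, LinearEquiv.apply_symm_apply,
        LinearEquiv.apply_symm_apply]
    have hγrat : IsRationalClass (e (ComplexTorus Φ) 1 (ComplexTorus.cconstClass Φ γ)) := by
      rw [heγ]; exact hrrat
    -- a non-zero lattice coordinate `g = γ(Φ e_{a₀})`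
    obtain ⟨a₀, ha₀⟩ : ∃ a₀ : ι, γ ![Φ (Pi.single a₀ (1 : ℝ))] ≠ 0 := by
      by_contra h
      push Not at h
      apply hr0
      rw [← heγ, ComplexTorus.eq_sum_apply_smul_dx Φ γ]
      simp [h]
    refine ⟨γ ![Φ (Pi.single a₀ (1 : ℝ))], ha₀, fun c => ?_⟩
    rw [← ComplexTorus.comp_realRep_elementary₁ Φ γ a₀ c]
    exact Literature.Barriers.HodgeConjecture.isRationalClass_cconstClass_comp_realRep Φ he _ hγrat

omit [FiniteDimensional ℂ E] in
/-- Hence **all the classes `e[g · Σₐ qₐ dxₐ]`, `q ∈ ℚ^ι`, are rational** (finite rational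
combinations of rational classes). [cite: LangeBirkenhake1992, §1.1.3 Lemma 1.1.17] -/
theorem isRationalClass_smul_sum_ratCast_smul_dx (e : ComplexDeRhamIsoFamily E) {g : ℂ}
    (hg : ∀ a : ι,
      IsRationalClass (e (ComplexTorus Φ) 1 (ComplexTorus.cconstClass Φ (g • ComplexTorus.dx Φ a))))
    (q : ι → ℚ) :
    IsRationalClass (e (ComplexTorus Φ) 1
      (ComplexTorus.cconstClass Φ (g • ∑ a, ((q a : ℚ) : ℂ) • ComplexTorus.dx Φ a))) := by
  have h : g • ∑ a, ((q a : ℚ) : ℂ) • ComplexTorus.dx Φ a =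
      ∑ a, ((q a : ℚ) : ℂ) • (g • ComplexTorus.dx Φ a) := by
    rw [Finset.smul_sum]
    exact Finset.sum_congr rfl fun a _ => smul_comm _ _ _
  rw [h, map_sum, map_sum]
  rw [show (∑ a, e (ComplexTorus Φ) 1
      (ComplexTorus.cconstClass Φ (((q a : ℚ) : ℂ) • (g • ComplexTorus.dx Φ a)))) =
      ∑ a, ((q a : ℚ) : ℂ) •
        e (ComplexTorus Φ) 1 (ComplexTorus.cconstClass Φ (g • ComplexTorus.dx Φ a)) from
    Finset.sum_congr rfl fun a _ => by
      rw [map_smul (ComplexTorus.cconstClass Φ) ((q a : ℚ) : ℂ) (g • ComplexTorus.dx Φ a),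
        map_smul (e (ComplexTorus Φ) 1) ((q a : ℚ) : ℂ)
          (ComplexTorus.cconstClass Φ (g • ComplexTorus.dx Φ a))]]
  exact IsRationalClass.sum_smul _ hg q

end RationalOneForms

end Literature.AlgebraicGeometry.HodgeTheory

end
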